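import Summits.BirchSwinnertonDyer.BirchSwinnertonDyer.Theorems.ClassRecordThreeEulerHalvesAtThreeWalkSupplyAtThreeNamedPrint
import Summits.BirchSwinnertonDyer.BirchSwinnertonDyer.Theorems.ErratumRoadFiveNonSurjCornerKolyJSupplyScopedAdm
import Summits.BirchSwinnertonDyer.BirchSwinnertonDyer.Theorems.ErratumRoadFiveNonSurjCornerKolyJSupplyStringentAdm
import Summits.BirchSwinnertonDyer.BirchSwinnertonDyer.Theorems.KatoDescentPotSupersingularWildJetchevBoundAtPHeegnerE0ImageFree
import Summits.BirchSwinnertonDyer.BirchSwinnertonDyer.Theorems.ErratumRoadFiveNonSurjCornerKolyJWalkOrders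
import Summits.BirchSwinnertonDyer.BirchSwinnertonDyer.Theorems.ErratumRoadFiveNonSurjCornerKolyJLevelOneSupply
import Summits.BirchSwinnertonDyer.Rank1Residual.X11b.RingClassFieldNoTorsionOfIrreducible
import HarnessLib

/-!
# Route `ClassRecordThree` (rung K2@3), crux `CornerAtThree` (item 19111): the per-frame SELMER supply of the (T4″)@3 corner's walk from
# Poitou–Tate + the image-free Gross 1991 §6 ∕ [GZ86 III (3.1)] — the @3 twin of `selmerSupplyCorner_of_poitouTate_Gross1991`
# (cell `bsd-stepL`, seat `bsd-stepL-corner-p1` g11; `--supports stmt-BirchSwinnertonDyer-19111`)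

WHY/WHAT. `selmerSupplyCornerThree_of_poitouTate_Gross1991 : hPT → Gross1991_heegnerPoint_sub_ratTorsion_mem_E0_imageFree → ‹the supply
hypothesis of hlevThree_of_pair_of_selmerSupply VERBATIM›` — tam3's `selmerSupplyAtThree_of_poitouTate_Gross1991` on the corner frame
`ClassX11b W 3`, `¬ Surj W 3` (`E[3]` irreducible instead of `ρ̄` onto; `3 ∣ N` from `Mult`; `p = 3` split in `K` from the Heegner
hypothesis): admissibility from x11b3 `NoTorsionIrr`, [GZ86 III (3.1)] from bsd-potss's image-free `forall_hGZ_of_Gross1991_imageFree`, all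
leaves `_of_admissible`. HONEST FRAMING: CONDITIONAL on the two named facts; no definition ∕ fact ∕ sorry; nothing about any curve; no stub
closes; T7. Credit: tam3-p1, bsd-jet, bsd-potss.
References: [cite: Jetchev2008, §3.1 item 7, §4.2, Prop. 4.5–4.9, Thm. 5.1, Lemma 5.2] [cite: GrossLMS1991, §6 proof of Prop. 6.2 (1)]
[cite: GrossZagier1986, III (3.1)] [cite: MilneADT2006, Ch. I, Thm. 4.10(b)].
-/

set_option autoImplicit false

noncomputable section

open scoped Classical NumberField Pointwise

namespace Summit.BirchSwinnertonDyer.Rank1Residual.X11b.Three.Koly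

open WeierstrassCurve IsDedekindDomain NumberField Field Literature.NumberTheory.EllipticCurves
  Literature.NumberTheory.EllipticCurves.ModularForms Literature.NumberTheory.EllipticCurves.Jetchev2008
  Literature.NumberTheory.EllipticCurves.KolyvaginCocycle
  Literature.NumberTheory.EllipticCurves.Rank1Residual Literature.NumberTheory.GaloisRepresentations
  Literature.NumberTheory.GaloisRepresentations.DiscreteGaloisModule
  Literature.NumberTheory.GaloisCohomology Literature.NumberTheory.Automorphic
  Summit.BirchSwinnertonDyer.Rank1Residual Summit.BirchSwinnertonDyer.Rank1Residual.X11b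
  Summit.BirchSwinnertonDyer.Rank1Residual.JET
  Summit.BirchSwinnertonDyer.Rank1Residual.JET.SelmerVocabulary
  Summit.BirchSwinnertonDyer.Rank1Residual.JET.Walk
  Summit.BirchSwinnertonDyer.BirchSwinnertonDyer.Theorems.HeegnerE0ImageFree

-- two ∀-closed hypotheses and a nine-conjunct ∃-conclusion: binder elaboration exceeds the default
set_option maxHeartbeats 800000 in
/-- **The (T4″)@3 corner's per-frame Selmer supply from Poitou–Tate + the image-free Gross 1991 §6 ∕ [GZ86 III (3.1)]**; see the
module docstring. [cite: Jetchev2008, §3.1 item 7, Prop. 4.5–4.9, Lemma 5.2] [cite: GrossZagier1986, III (3.1)] -/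
theorem selmerSupplyCornerThree_of_poitouTate_Gross1991
    (hPT : ∀ (K : Type) [Field K] [NumberField K], poitouTate_selmerStructure_duality_conj K)
    (hF1 : Gross1991_heegnerPoint_sub_ratTorsion_mem_E0_imageFree) :
    ∀ (W : WeierstrassCurve ℚ) [W.IsElliptic] [W.IsGloballyMinimal] [NeZero (W.conductorNorm ℤ)]
      (K : Type) [Field K] [NumberField K]
      (Dt : ModularParametrizationData W (W.conductorNorm ℤ)) (β : ℤ) (ι : K →+* ℂ),
      ClassX11b W 3 → ¬ Surj W 3 →
      IsImaginaryQuadratic K → SatisfiesHeegnerHypothesis (W.conductorNorm ℤ) K →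
      Odd (NumberField.discr K) →
      (4 * (W.conductorNorm ℤ : ℤ)) ∣ β ^ 2 - NumberField.discr K → ¬ (3 : ℤ) ∣ Dt.c →
      ∀ (τ : K ≃ₐ[ℚ] K), τ ≠ 1 → ∀ (v : HeightOneSpectrum (𝓞 ℚ)) (k : ℕ), 1 ≤ k →
        padicValNat 3 (W.tamagawaNumberAt v) ≤ k →
      ∀ (n : ℕ) (d : KolyvaginHeegnerData Dt β ι n) (hn : Squarefree n ∧ ∀ q ∈ n.primeFactors,
        Zhang2014.IsKolyvaginPrime (W.conductorNorm ℤ) W K 3 q ∧ k ≤ Zhang2014.kolyvaginIndex W 3 q),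
      ∀ (D : ∀ s : {m : ℕ // Squarefree m ∧ ∀ q ∈ m.primeFactors,
        Zhang2014.IsKolyvaginPrime (W.conductorNorm ℤ) W K 3 q ∧ k ≤ Zhang2014.kolyvaginIndex W 3 q},
          KolyvaginHeegnerData Dt β ι s.1), D ⟨n, hn⟩ = d →
      ∀ (ε : ℤ), (ε = 1 ∨ ε = -1) → ∀ (eb : ℕ → Bool),
        (∀ (m ℓ : ℕ), ℓ.Prime → ¬ ℓ ∣ m → eb (m * ℓ) = !eb m) →
        (∀ m, (if eb m then (1 : ℤ) else -1) = ε * (-1) ^ m.primeFactors.card) →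
      ∃ (𝒯 𝒮 : SelmerStructure ((W.baseChange K).torsionGaloisModule ((3 ^ k : ℕ) : ℤ)))
        (Qcar : Finset (HeightOneSpectrum (𝓞 K)))
        (C' : ℕ → AddSubgroup (galoisCohomology ((W.baseChange K).torsionGaloisModule ((3 ^ k : ℕ) : ℤ)) 1)),
        (∀ v, 𝒮 v ≤ (W.baseChange K).kummerSelmerStructure ((3 ^ k : ℕ) : ℤ) v) ∧
        (∀ v ∈ Qcar, ((W.conductorNorm ℤ : ℕ) : 𝓞 K) ∈ v.asIdeal) ∧
        (∀ (ℓ : ℕ), Zhang2014.IsKolyvaginPrime (W.conductorNorm ℤ) W K 3 ℓ →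
      k ≤ Zhang2014.kolyvaginIndex W 3 ℓ → ¬ ℓ ∣ n → ∀ v : HeightOneSpectrum (𝓞 K), (ℓ : 𝓞 K) ∈ v.asIdeal →
      Disjoint ((W.baseChange K).kummerSelmerStructure ((3 ^ k : ℕ) : ℤ) (Sum.inr v)) (𝒯 (Sum.inr v))) ∧
        (∀ (s : {m : ℕ // Squarefree m ∧ ∀ q ∈ m.primeFactors,
        Zhang2014.IsKolyvaginPrime (W.conductorNorm ℤ) W K 3 q ∧ k ≤ Zhang2014.kolyvaginIndex W 3 q})
      (ℓ : ℕ), Zhang2014.IsKolyvaginPrime (W.conductorNorm ℤ) W K 3 ℓ →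
      k ≤ Zhang2014.kolyvaginIndex W 3 ℓ → ¬ ℓ ∣ s.1 → (∀ q ∈ s.1.primeFactors, q < ℓ) → n ∣ s.1 →
      ∀ v : HeightOneSpectrum (𝓞 K), (ℓ : 𝓞 K) ∈ v.asIdeal → ∀ b : Bool,
      Nat.card ((signPart W K τ ((3 ^ k : ℕ) : ℤ) (if b then 1 else -1)
          ((selmerF W ((3 ^ k : ℕ) : ℤ) 𝒯 (placesDividing K s.1)).relaxedAt {v}).selmerGroup).map
        (galoisCohomology.localization ((W.baseChange K).torsionGaloisModule ((3 ^ k : ℕ) : ℤ))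
          (Sum.inr v) 1)) = 3 ^ k) ∧
        (∀ s (u : ℕ) (Q : (W.baseChange (ringClassField K ι s.1)).toAffine.Point)
      (hAk : IsAdmissible (absoluteGaloisGroup K) (D s).pointsSubgroup ((3 ^ k : ℕ) : ℤ))
      (hQ : (D s).toGeomPoints Q ∈ invPoints (absoluteGaloisGroup K) (D s).pointsSubgroup ((3 ^ k : ℕ) : ℤ)),
      ((3 ^ u : ℕ) : ℤ) • Q = (D s).derivedPoint →
      (¬ ∃ Q' : (W.baseChange (ringClassField K ι s.1)).toAffine.Point,
        ((3 ^ (u + 1) : ℕ) : ℤ) • Q' = (D s).derivedPoint) →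
      ((u + k : ℕ) : ℕ∞) ≤ Zhang2014.levelIndex W 3 s.1 →
      (kolyvaginClass (W.baseChange K) ((3 ^ k : ℕ) : ℤ)
        ((W.baseChange K).zsmul_geomPoints_surjective_of_charZero
          (by exact_mod_cast pow_ne_zero k Nat.prime_three.ne_zero)) hAk ((D s).toGeomPoints Q) hQ :
          galoisCohomology ((W.baseChange K).torsionGaloisModule ((3 ^ k : ℕ) : ℤ)) 1) ∈
        (selmerF W ((3 ^ k : ℕ) : ℤ) 𝒯 (placesDividing K s.1)).selmerGroup) ∧
        (∀ m, C' m ≤ signPart W K τ ((3 ^ k : ℕ) : ℤ) (if !eb m then 1 else -1) ⊤) ∧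
        (∀ s : {m : ℕ // Squarefree m ∧ ∀ q ∈ m.primeFactors,
        Zhang2014.IsKolyvaginPrime (W.conductorNorm ℤ) W K 3 q ∧ k ≤ Zhang2014.kolyvaginIndex W 3 q},
      n ∣ s.1 → ∃ (Qg Qg' : Type) (_ : AddCommGroup Qg) (_ : AddCommGroup Qg') (_ : Finite Qg')
        (locq : signPart W K τ ((3 ^ k : ℕ) : ℤ) (if !eb s.1 then 1 else -1)
            (selmerF W ((3 ^ k : ℕ) : ℤ) 𝒯 (placesDividing K s.1)).selmerGroup →+ Qg)
        (locq' : C' s.1 →+ Qg'),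
        (∀ x : C' s.1, locq' x = 0 ↔
          (x : galoisCohomology ((W.baseChange K).torsionGaloisModule ((3 ^ k : ℕ) : ℤ)) 1) ∈
            signPart W K τ ((3 ^ k : ℕ) : ℤ) (if !eb s.1 then 1 else -1)
              (selmerF W ((3 ^ k : ℕ) : ℤ) 𝒯 (placesDividing K s.1)).selmerGroup) ∧
        Nat.card locq.range * Nat.card locq'.range = Nat.card Qg' ∧ IsAddCyclic Qg' ∧
        Nat.card Qg' = 3 ^ padicValNat 3 (W.tamagawaNumberAt v)) ∧
        (∀ (s s' : {m : ℕ // Squarefree m ∧ ∀ q ∈ m.primeFactors,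
        Zhang2014.IsKolyvaginPrime (W.conductorNorm ℤ) W K 3 q ∧ k ≤ Zhang2014.kolyvaginIndex W 3 q})
      (ℓ : ℕ), ℓ.Prime → ¬ ℓ ∣ s.1 → s'.1 = s.1 * ℓ → (∀ q ∈ s.1.primeFactors, q < ℓ) → n ∣ s.1 →
      ∀ v : HeightOneSpectrum (𝓞 K), (ℓ : 𝓞 K) ∈ v.asIdeal →
      ((D s').kolyvaginClass Nat.prime_three k :
          galoisCohomology ((W.baseChange K).torsionGaloisModule ((3 ^ k : ℕ) : ℤ)) 1) ∈
        (((selmerF0 W ((3 ^ k : ℕ) : ℤ) 𝒯 𝒮 (placesDividing K s.1) Qcar).relaxedAt {v}).selmerGroup)) ∧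
        (∀ (s : {m : ℕ // Squarefree m ∧ ∀ q ∈ m.primeFactors,
        Zhang2014.IsKolyvaginPrime (W.conductorNorm ℤ) W K 3 q ∧ k ≤ Zhang2014.kolyvaginIndex W 3 q})
      (ℓ : ℕ), Zhang2014.IsKolyvaginPrime (W.conductorNorm ℤ) W K 3 ℓ →
      k ≤ Zhang2014.kolyvaginIndex W 3 ℓ → ¬ ℓ ∣ s.1 → (∀ q ∈ s.1.primeFactors, q < ℓ) → n ∣ s.1 →
      ∀ v : HeightOneSpectrum (𝓞 K), (ℓ : 𝓞 K) ∈ v.asIdeal →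
      ∃ (Sg : Type) (_ : AddCommGroup Sg)
        (sing : signPart W K τ ((3 ^ k : ℕ) : ℤ) (if !eb s.1 then 1 else -1)
            (((selmerF0 W ((3 ^ k : ℕ) : ℤ) 𝒯 𝒮 (placesDividing K s.1) Qcar).relaxedAt {v}).selmerGroup)
          →+ Sg),
        (∀ x, sing x = 0 ↔
          (x : galoisCohomology ((W.baseChange K).torsionGaloisModule ((3 ^ k : ℕ) : ℤ)) 1) ∈
            signPart W K τ ((3 ^ k : ℕ) : ℤ) (if !eb s.1 then 1 else -1)
              ((selmerF0 W ((3 ^ k : ℕ) : ℤ) 𝒯 𝒮 (placesDividing K s.1) Qcar).selmerGroup)) ∧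
        Nat.card sing.range *
          Nat.card ((C' s.1).map (galoisCohomology.localization
            ((W.baseChange K).torsionGaloisModule ((3 ^ k : ℕ) : ℤ)) (Sum.inr v) 1)) = 3 ^ k) := by
  intro W _ _ _ K _ _ Dt β ι hX hns hK hHN hodd hβ hc τ hτ v k hk htk n d hn D hDd ε hε eb heb hebε
  have hp : (3 : ℕ).Prime := Nat.prime_three
  haveI : Fact (3 : ℕ).Prime := ⟨hp⟩
  haveI hRCF' : ∀ j : ℕ, NumberField (ringClassField K ι j) := fun j ↦ numberField_ringClassField K hK ι j
  have hp2 : (3 : ℕ) ≠ 2 := by decide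
  have hirr : W.HasIrreducibleModPGaloisRep 3 := hX.2.2.2
  have h3n : ((3 ^ k : ℕ) : ℤ) ≠ 0 := by exact_mod_cast pow_ne_zero k hp.ne_zero
  haveI : NeZero (3 ^ k) := ⟨pow_ne_zero k hp.ne_zero⟩
  haveI : Finite (geomTorsion (W.baseChange K) ((3 ^ k : ℕ) : ℤ)) :=
    finite_geomTorsion_of_neZero (W.baseChange K) (3 ^ k)
  -- frame facts: `(N, d_K) = 1`, `d_K < -4`, `p ∣ N`, `τ² = 1`
  have hND : IsCoprime ((W.conductorNorm ℤ : ℕ) : ℤ) (NumberField.discr K) :=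
    KolyvaginAssembly.isCoprime_discr_of_satisfiesHeegnerHypothesis hK hHN
  have h3N : 3 ∣ W.conductorNorm ℤ := dvd_conductorNorm_of_mult (W := W) hX.2.2.1
  have hHp : SatisfiesHeegnerHypothesis 3 K := hHN.of_dvd h3N
  have h3d : ¬ (3 : ℤ) ∣ NumberField.discr K := by
    exact_mod_cast Literature.SatisfiesHeegnerHypothesis.not_dvd_discr hK.1 hHN Nat.prime_three h3N
  have hd : 4 < (NumberField.discr K).natAbs := four_lt_natAbs_discr_of_odd hK.1 hodd h3d
  have hDneg : NumberField.discr K < 0 := (isImaginaryQuadratic_iff_discr_neg.1 hK).2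
  have hD : NumberField.discr K < -4 := by omega
  have hD3 : NumberField.discr K ≠ -3 := by omega
  have hD4 : NumberField.discr K ≠ -4 := by omega
  have hτ2 : τ * τ = 1 := algEquiv_mul_self_eq_one hK τ hτ
  -- admissibility on the irreducible cell, at every level, for data at conductors prime to `p`
  have hKunr : ∀ v : HeightOneSpectrum (𝓞 ℚ), ((3 : ℕ) : 𝓞 ℚ) ∈ v.asIdeal →
      Algebra.IsUnramifiedIn (𝓞 K) v.asIdeal :=
    isUnramifiedIn_of_satisfiesHeegnerHypothesis_of_dvd hK hHp hp (dvd_refl 3)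
  have hAdm : ∀ (j m : ℕ) (dm : KolyvaginHeegnerData Dt β ι m), Squarefree m →
      (∀ q ∈ m.primeFactors, Zhang2014.IsKolyvaginPrime (W.conductorNorm ℤ) W K 3 q) →
      IsAdmissible (absoluteGaloisGroup K) dm.pointsSubgroup ((3 ^ j : ℕ) : ℤ) :=
    fun j m dm hm hmK ↦ NoTorsionIrr.isAdmissible_pointsSubgroup_of_hasIrreducibleModPGaloisRep dm hK hm.ne_zero hp
      hp2 hirr (W.exists_weilPairing_holds 3) hKunr (not_dvd_of_forall_isKolyvaginPrime W hm.ne_zero hmK) j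
  -- admissible numbers are divisor-closed; the data system at the divisors of an admissible `s`
  have hadm : ∀ (s : {m : ℕ // Squarefree m ∧ ∀ q ∈ m.primeFactors,
      Zhang2014.IsKolyvaginPrime (W.conductorNorm ℤ) W K 3 q ∧ k ≤ Zhang2014.kolyvaginIndex W 3 q})
      (m : ℕ), m ∣ s.1 → Squarefree m ∧ ∀ q ∈ m.primeFactors,
      Zhang2014.IsKolyvaginPrime (W.conductorNorm ℤ) W K 3 q ∧ k ≤ Zhang2014.kolyvaginIndex W 3 q :=
    fun s m hm ↦ ⟨s.2.1.squarefree_of_dvd hm,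
      fun q hq ↦ s.2.2 q (Nat.primeFactors_mono hm s.2.1.ne_zero hq)⟩
  -- Gross 1991 §6 ∕ [GZ86 III (3.1)] at this frame, image-free (bsd-potss), Kolyvagin-scoped receptacle form
  obtain ⟨n', hcop', hGZ'⟩ := forall_hGZ_of_Gross1991_imageFree hF1 W K hK hD3 hD4 hHN 3 hp2 hirr Dt β ι
  -- the GLOBAL intrinsic transverse family at level `p^k`
  obtain ⟨𝒯, h𝒯, -⟩ := exists_globalTransverseFamily W ι ((3 ^ k : ℕ) : ℤ)
  -- the transverse local facts for the global family at the places of every admissible conductor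
  have h𝒯σ' : ∀ (s : {m : ℕ // Squarefree m ∧ ∀ q ∈ m.primeFactors,
        Zhang2014.IsKolyvaginPrime (W.conductorNorm ℤ) W K 3 q ∧ k ≤ Zhang2014.kolyvaginIndex W 3 q})
      (v w : HeightOneSpectrum (𝓞 K)) (h : τ • v = w), v ∈ placesDividing K s.1 →
      ∀ x : galoisCohomology (((W.baseChange K).torsionGaloisModule ((3 ^ k : ℕ) : ℤ)).toLocal
        (Sum.inr v : Place K)) 1,
      x ∈ 𝒯 (Sum.inr v) → conjActPlace W τ ((3 ^ k : ℕ) : ℤ) h x ∈ 𝒯 (Sum.inr w) :=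
    fun s v w h hv x hx ↦ globalTransverse_conjActPlace_mem h𝒯 τ s.2.1
      (forall_conjActPlace_mem_of_eq_iInf_transverseSubgroup W hK ι τ _ s.1) v w h hv x hx
  -- the carrier package: `𝒮`, the split place `v₀`, (δ) of order `p^t`, membership at the carrier
  obtain ⟨𝒮, v₀, hS, hv₀, hv₀N, hv₀N', h𝒮σ, hcyc, hidx, h𝒮mem⟩ :=
    exists_carrierPackage_kolyvagin_of_admissible W K hK hD3 hD4 τ hτ hHN 3 hp2 h3N Dt β ι hcop' hGZ'
      kodairaNeron_isAddCyclic_forall v k h3n htk (fun m dm hm hmK ↦ hAdm k m dm hm hmK)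
      (fun c hc hcK q hqN ℓ hℓK hkℓ hℓc d' ↦
        localization_kolyvaginClass_mem_stringentFamily_carrier_kolyvagin_of_admissible W K hK hD3 hD4 hHN Dt β ι
          hcop' hGZ' τ h3n hc hcK q hqN (fun m dm hm hmK ↦ hAdm k m dm hm hmK) ℓ hℓK hkℓ hℓc d' q
          (Finset.mem_insert_self _ _))
  -- the duality conjuncts (bsd-jet Poitou–Tate packages; Weil datum and `τ² = 1` inside)
  obtain ⟨C', hC, hdual_q, hdual_ℓ⟩ := exists_dualityConjuncts_of_localFacts W (hPT K) hK ι τ hτ 3 k hp2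
    hk h𝒯 (fun c _ _ 𝒯c h𝒯c ↦ forall_conjActPlace_mem_of_eq_iInf_transverseSubgroup W hK ι τ _ c 𝒯c h𝒯c)
    (fun c hc hcK 𝒯c h𝒯c e hμ hadd₁ hadd₂ hgal halt hnondeg inv hperf w hw ↦
      RingClassTransverse.dualTransported_eq_of_localTransverseFamily W K hK hD ι 3 hp2 k hk c hc
        (fun ℓ hℓ ↦ (hcK ℓ hℓ).1) (fun ℓ hℓ ↦ (hcK ℓ hℓ).2) 𝒯c h𝒯c e hμ hadd₁ hadd₂ hgal halt hnondeg
        inv hperf w hw)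
    (kolyvaginLocalTerm_of_poitouTate hPT W K hK τ hτ 3 k hp2 hk) eb n 𝒮 hS v₀ hv₀
    hv₀N h𝒮σ hcyc hidx
  refine ⟨𝒯, 𝒮, {v₀, τ • v₀}, C', hS, ?_, ?_, ?_, ?_, hC, hdual_q, ?_, hdual_ℓ⟩
  · -- hQcar
    intro q hq
    simp only [Finset.mem_insert, Finset.mem_singleton] at hq
    rcases hq with rfl | rfl <;> assumption
  · -- hdisj ([J] §4.2 at one completion)
    intro ℓ hℓK hkℓ _ w hw
    exact globalTransverse_disjoint_kummer h𝒯
      (P := fun ℓ ↦ Zhang2014.IsKolyvaginPrime (W.conductorNorm ℤ) W K 3 ℓ ∧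
        k ≤ Zhang2014.kolyvaginIndex W 3 ℓ)
      (fun ℓ hℓ w hw ↦ disjoint_kummer_iInf_transverseSubgroup W K hK hD ι k hℓ.1 w hw)
      (fun ℓ hℓ ↦ hℓ.1.1) ℓ ⟨hℓK, hkℓ⟩ w hw
  · -- hPT (Lemma 5.2 (iii), primal form)
    intro s ℓ hℓK hkℓ hℓs _ _ w hw b
    obtain ⟨inv, hperf, hvan, -, hSC, hconj⟩ := hPT K (3 ^ k)
    have h2 : 2 ≤ 3 ^ k := le_trans hp.two_le (Nat.le_self_pow (by omega) 3)
    obtain ⟨e, hμ, hadd₁, hadd₂, hgal, halt, hnondeg, hτe⟩ := exists_weilDatum_liftAut W τ (3 ^ k) h2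
    have hs' : (if b then (1 : ℤ) else -1) = 1 ∨ (if b then (1 : ℤ) else -1) = -1 := by
      cases b <;> simp
    have hℓs' : ℓ ∉ s.1.primeFactors := fun h ↦ hℓs (Nat.dvd_of_mem_primeFactors h)
    exact natCard_map_localization_signPart_relaxedAt W τ 3 k e hμ hadd₁ hadd₂ hgal halt hnondeg hτe
      hτ2 hp2 hk inv hperf hvan hSC (hconj τ) 𝒯 s.2.1.ne_zero (h𝒯σ' s)
      (globalTransverse_dualTransported_eq (ι := ι) h𝒯 s.2.1
        (fun 𝒯c h𝒯c inv' hperf' w' hw' ↦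
          RingClassTransverse.dualTransported_eq_of_localTransverseFamily W K hK hD ι 3 hp2 k hk s.1 s.2.1
            (fun ℓ hℓ ↦ (s.2.2 ℓ hℓ).1) (fun ℓ hℓ ↦ (s.2.2 ℓ hℓ).2) 𝒯c h𝒯c e hμ hadd₁ hadd₂ hgal halt
            hnondeg inv' hperf' w' hw')
        inv hperf)
      hs' (fun ℓ' h1 h2 _ v' hv' hfix ↦
        kolyvaginLocalTerm_of_poitouTate hPT W K hK τ hτ 3 k hp2 hk ℓ' h1 h2 v' hv' hfix _ hs')
      ℓ hℓK hkℓ hℓs' w hw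
  · -- hselmer (root classes)
    intro s u Q hAk hQ hQP hndvd huk
    have hsKu : ∀ q ∈ s.1.primeFactors, Zhang2014.IsKolyvaginPrime (W.conductorNorm ℤ) W K 3 q ∧
        k + u ≤ Zhang2014.kolyvaginIndex W 3 q := fun q hq ↦
      ⟨(s.2.2 q hq).1, by
        rw [Nat.add_comm]
        exact Zhang2014.natCast_le_levelIndex_iff.mp huk q hq⟩
    -- invariance of `[P_s]` mod `p^{k+u}` from the data at the divisors of `s`
    have hP : (D s).toGeomPoints (D s).derivedPoint ∈
        invPoints (absoluteGaloisGroup K) (D s).pointsSubgroup ((3 ^ (k + u) : ℕ) : ℤ) :=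
      KolyCert.toGeomPoints_derivedPoint_mem_invPoints_of_dvd_zhang hK ι Dt hp hND hD s.2.1 hsKu
        (fun m hm ↦ D ⟨m, hadm s m hm⟩) s.1 dvd_rfl
    exact rootClass_mem_selmerGroup_selmerF_of_levelUp_kolyvagin_of_admissible W h𝒯 hK hD3 hD4 hHN hcop' hGZ'
      s.2.1 hsKu (D s) Q hAk hQ hQP (hAdm (k + u) s.1 (D s) s.2.1 fun q hq ↦ (s.2.2 q hq).1)
      (fun m hm dm ↦ hAdm (k + u) m dm (s.2.1.squarefree_of_dvd hm)
        fun q hq ↦ (s.2.2 q (Nat.primeFactors_mono hm s.2.1.ne_zero hq)).1)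
      hP (fun ℓ hℓ ↦ kolyvaginClass_mem_transverseKer W hK hD hp2 Dt β ι (k + u) s.2.1 hsKu (D s) hℓ)
  · -- hsel0
    intro s s' ℓ hℓ hℓs hss' _ _ w hw
    have hs0 : s.1 ≠ 0 := s.2.1.ne_zero
    have hℓs' : ℓ ∈ s'.1.primeFactors := by
      rw [hss']; exact Nat.mem_primeFactors.mpr ⟨hℓ, dvd_mul_left ℓ s.1, mul_ne_zero hs0 hℓ.ne_zero⟩
    have hℓK : Zhang2014.IsKolyvaginPrime (W.conductorNorm ℤ) W K 3 ℓ := (s'.2.2 ℓ hℓs').1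
    have hkℓ : k ≤ Zhang2014.kolyvaginIndex W 3 ℓ := (s'.2.2 ℓ hℓs').2
    have hℓs'' : ℓ ∉ s.1.primeFactors := fun h ↦ hℓs (Nat.dvd_of_mem_primeFactors h)
    have htr' : ∀ q ∈ s.1.primeFactors,
        ((D s').kolyvaginClass (Fact.out : (3 : ℕ).Prime) k :
          galoisCohomology ((W.baseChange K).torsionGaloisModule ((3 ^ k : ℕ) : ℤ)) 1) ∈
          transverseKer W K ι ((3 ^ k : ℕ) : ℤ) q := fun q hq ↦
      kolyvaginClass_mem_transverseKer W hK hD hp2 Dt β ι k s'.2.1 s'.2.2 (D s')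
        (by rw [hss']; exact Nat.primeFactors_mono (dvd_mul_right s.1 ℓ) (mul_ne_zero hs0 hℓ.ne_zero) hq)
    exact kolyvaginClass_mem_selmerGroup_selmerF0_relaxedAt_kolyvagin_of_admissible W h𝒯 hK hD3 hD4 hHN hcop' hGZ' 𝒮
      {v₀, τ • v₀} s.2.1 s.2.2 hℓK hkℓ hℓs hss' (D s')
      (fun m hm dm ↦ hAdm k m dm (s'.2.1.squarefree_of_dvd (hss' ▸ hm))
        fun q hq ↦ (s'.2.2 q (Nat.primeFactors_mono (hss' ▸ hm) (hss' ▸ s'.2.1.ne_zero) hq)).1)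
      w hw htr'
      (fun q hq ↦ by
        have := h𝒮mem q hq s.1 s.2.1 s.2.2 ℓ hℓK hkℓ hℓs''
        rw [← hss'] at this
        exact this (D s'))

end Summit.BirchSwinnertonDyer.Rank1Residual.X11b.Three.Koly

end
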